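import Summits.BirchSwinnertonDyer.BirchSwinnertonDyer.Theorems.EisensteinPrimesResidualIndexAssembly
import Summits.BirchSwinnertonDyer.Rank1Residual.X2.ResidualDevissageModules
import Literature.NumberTheory.GaloisCohomology.PoitouTateRestrictedRamification
import Literature.NumberTheory.EllipticCurves.PAdicHeights
import Summits.BirchSwinnertonDyer.BirchSwinnertonDyer.Theorems.EisensteinPrimesGoodLatticeBDPValueIndexInputsStub
import Summits.BirchSwinnertonDyer.BirchSwinnertonDyer.Theorems.EisensteinPrimesIndexPlumbingLambdaLE
import Summits.BirchSwinnertonDyer.BirchSwinnertonDyer.Theorems.EisensteinPrimesAnticyclotomicLocalCdOne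
import Summits.BirchSwinnertonDyer.BirchSwinnertonDyer.Theorems.EisensteinPrimesAnomalousTowerTorsionFinite
import Summits.BirchSwinnertonDyer.BirchSwinnertonDyer.Theorems.EisensteinPrimesFSideCorankLe
import Literature.NumberTheory.EllipticCurves.CastellaGrossiLeeSkinner2022.KatzPAdicLFunctionExistence
import Summits.BirchSwinnertonDyer.BirchSwinnertonDyer.Theorems.EisensteinPrimesGoodLatticeBDPValueStubKatzLineIntFrameQ
import Summits.BirchSwinnertonDyer.BirchSwinnertonDyer.Theorems.EisensteinPrimesKatzLineDescentOfThm212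
import Summits.BirchSwinnertonDyer.BirchSwinnertonDyer.Theorems.EisensteinPrimesGoodLatticeImprimitiveOfQuotient
import Summits.BirchSwinnertonDyer.BirchSwinnertonDyer.Theorems.EisensteinPrimesGoodLatticeQuotientOfCorank
import Summits.BirchSwinnertonDyer.BirchSwinnertonDyer.Theorems.EisensteinPrimesGoodLatticeCorankOfGe
import Summits.BirchSwinnertonDyer.BirchSwinnertonDyer.Theorems.EisensteinPrimesAcTwistDeformationImprimCorank
import Summits.BirchSwinnertonDyer.BirchSwinnertonDyer.Theorems.EisensteinPrimesGoodLatticeBDPValueStubIndexPlumbing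
import HarnessLib
/-!
# Crux 2 `GoodLatticeBDPValue` (stmt-BirchSwinnertonDyer-19032) MODULO ITS NAMED FACTS — part 1/2 ([ALG-imp-λ] glue)

LEAD bsd-line-x1-p1 (gen 5), cell `bsd-eis`. The registered line `halves` (skeleton v22, `Cruxes/GoodLatticeBDPValue/Lines/halves.lean`,
sha256 873a80a3…) has NO KERNEL STUB left: its five `sorry`s are NAMED-FACT bundles (20 PUBLISHED facts by name) and the
PUB-composed candidate 3a-A. These two files (`…OfNamedFactsALG`, `…OfNamedFacts`) are that skeleton with every stub turned into
an explicit HYPOTHESIS (section `variable`s, `include`d where used) — i.e. the sorry-free, gate-checked form of the statement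
«crux 2 holds modulo exactly these named facts»: the last theorem of part 2,
`GoodLatticeBDPValueOfNamedFacts.goodLatticeBDPValue_of_namedFacts`, has type
`⟨stub 1: 7 PUB⟩ → ⟨3a-A⟩ → ⟨stub 4: 8 PUB⟩ → ⟨stub 4b: 4 PUB⟩ → ⟨CD2⟩ → Summit.….Theses.EisensteinPrimes.GoodLatticeBDPValue`.
This part carries the [ALG-imp-λ] glue (`imprimLambdaLE_of_index`; the plumbing step is w8's landed `IndexPlumbingNrVsStrict.stub_indexPlumbing` p652091) verbatim from the skeleton (LEAD g4's V21
index road: p652703 `GoodLatticeBDPValueIndexStubs.indexInputs`, p645893 `ResidualIndexAssembly`, w8's p651468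
`IndexPlumbingNrVsStrict.lambdaInvariant_add_le_of_mid`). HONEST FRAMING: CONDITIONAL theorems (hypotheses = published results
as `Prop`s + 3a-A); no named fact is discharged, no summit statement / BSD / IMC / Keller–Yin theorem is proved; 0 sorry.
[cite: KellerYin2024, Thm. 1.4.1 (iii), Thm. 3.0.8] [cite: Greenberg2016Selmer, Prop. 4.1.1, 4.2.2] [cite: Greenberg2006, §5 A, Prop. 4.1, 4.2, 3.2]
-/


-- `Summit.BirchSwinnertonDyer.BirchSwinnertonDyer.…`: the summit and its single sub-problem share a name (D-0017 layout).
set_option linter.dupNamespace false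
set_option autoImplicit false
open scoped Classical

open PowerSeries WeierstrassCurve NumberField IsDedekindDomain Field
  Literature.NumberTheory.GaloisRepresentations Literature.NumberTheory.EllipticCurves.GreenbergVatsal2000
  Summit.BirchSwinnertonDyer.BirchSwinnertonDyer.Theorems.EisensteinPrimesMuLambda
  Literature.NumberTheory.EllipticCurves Literature.NumberTheory.EllipticCurves.ModularForms
  Literature.NumberTheory.EllipticCurves.Rank1Residual Literature.NumberTheory.EllipticCurves.Castella2018
  Literature.NumberTheory.EllipticCurves.GreenbergSelmer Literature.NumberTheory.QuadraticFields
  Literature.NumberTheory.EllipticCurves.CastellaGrossiLeeSkinner2022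
  Literature.NumberTheory.EllipticCurves.KellerYin2024 Literature.NumberTheory.EllipticCurves.IwasawaAlgebra
  Literature.NumberTheory.EllipticCurves.Rubin1991 Literature.NumberTheory.EllipticCurves.DeShalit1987
  Literature.NumberTheory.EllipticCurves.Hida2010MuInvariant Literature.NumberTheory.EllipticCurves.BCGKPST2020
open Literature.NumberTheory.IwasawaTheory Literature.NumberTheory.IwasawaTheory.Greenberg2016
  Literature.NumberTheory.IwasawaTheory.Greenberg2006
open Summit.BirchSwinnertonDyer.Rank1Residual.X1.KellerYinHalves
  Summit.BirchSwinnertonDyer.Rank1Residual.X2.ResidualDevissageModules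
  Summit.BirchSwinnertonDyer.Rank1Residual.X1.KellerYinMuLambdaSplitDSFree
  Summit.BirchSwinnertonDyer.BirchSwinnertonDyer.Theorems
  Summit.BirchSwinnertonDyer.BirchSwinnertonDyer.Theorems.GoodLatticeBDPValueHalves
  Summit.BirchSwinnertonDyer.BirchSwinnertonDyer.Theorems.GoodLatticeBDPValueOfImprimitive
  Summit.BirchSwinnertonDyer.BirchSwinnertonDyer.Theorems.GoodLatticeBDPValueOfOneInequality
  Summit.BirchSwinnertonDyer.BirchSwinnertonDyer.Theorems.GoodLatticeImprimitiveOfQuotient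
  Summit.BirchSwinnertonDyer.BirchSwinnertonDyer.Theorems.GoodLatticeQuotientOfCorank
  Summit.BirchSwinnertonDyer.BirchSwinnertonDyer.Theorems.GoodLatticeCorankOfGe

namespace Summit.BirchSwinnertonDyer.BirchSwinnertonDyer.Theorems.GoodLatticeBDPValueOfNamedFactsALG

section

variable (stub_publishedFactsGreenberg :
    prop411_selmer_isAlmostDivisible ∧ prop422_localCohomology_isAlmostDivisible ∧
      sec5A_localH2_subsingleton_of_LOC1 ∧ prop41_globalEulerPoincareCorank ∧
      prop42_localEulerPoincareCorank ∧ prop32_cohomology_isCofinitelyGenerated ∧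
      BCGKPST2020.sec33_rubin_unrSelmer₂_finite_torsion ∧
      weakLeopoldt_H2_subsingleton_above_cyclotomic_of_isOpen)
  (stub_publishedFactsMore :
    prop263_sur_of_crk ∧ thm222_anacong_goodLattice_of_five_le ∧ thm222_anacong_goodLattice_of_ne_one ∧
      thm212_exists_isKatzLFunction)
  (stub_publishedFactCD2 :
    ∀ (L : Type) [Field L] [NumberField L],
      Literature.NumberTheory.GaloisCohomology.groupCdLE_two_galoisGroupUnramifiedOutside L)

include stub_publishedFactsGreenberg stub_publishedFactsMore stub_publishedFactCD2 in
/-- **[ALG-imp-λ] in cotorsion `≤` form, derived**: the `≤` half of v19.1's PRE stub `stub_imprimLambda` with the cotorsion /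
`μ = 0` antecedents (= the hypothesis `h141leTD` of `GoodLatticeBDPValueOfLambdaInequalityAnQ`), from stub 2a-I (inputs,
fed the PUB facts of stubs 4/4b), the LANDED mid-level composition `ResidualIndexAssembly.zpCorank_datumStrictSelmer_add_eq`
(p645893) and stub 2a-II (plumbing). [cite: KellerYin2024, Thm. 1.4.1 (iii)] -/
theorem imprimLambdaLE_of_index :
    ∀ (W : WeierstrassCurve ℚ) [W.IsElliptic] [W.IsGloballyMinimal] (p : ℕ) [Fact p.Prime],
      2 < p → Good W p → Red W p → Anom W p →
      (∀ Φ : AddSubgroup (geomTorsion W (p : ℤ)), IsRationalLine W p Φ → ¬ LineUnramifiedAt W p Φ) →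
      ∀ (K : Type) [Field K] [NumberField K], IsImaginaryQuadratic K →
        SatisfiesHeegnerHypothesis (W.conductorNorm ℤ) K → SatisfiesHeegnerHypothesis p K →
        (∀ Q : (W.baseChange K).toAffine.Point, p • Q = 0 → Q = 0) →
      ∀ (ι : K →+* ℚ_[p]) (v vbar : HeightOneSpectrum (𝓞 K)),
        (∀ x : 𝓞 K, x ∈ v.asIdeal ↔ ‖ι (x : K)‖ < 1) →
        ((p : ℕ) : 𝓞 K) ∈ vbar.asIdeal → vbar ≠ v →
      ∀ (κ : ZpExtension K p), κ.IsAnticyclotomic →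
      ∀ (γ : absoluteGaloisGroup K) [Fact (κ.IsTopGenerator γ)],
      ∀ (θsub θquot : FramedGaloisRep K (padicCoeffIntegers (∅ : Set (PadicAlgCl p))) 1),
        IsResidualPairOver (W.baseChange K) p θsub θquot →
      ∀ (Sf : Finset (HeightOneSpectrum (𝓞 K))),
        (∀ w : HeightOneSpectrum (𝓞 K), w ∈ Sf ↔ ((W.conductorNorm ℤ : ℤ) : 𝓞 K) ∈ w.asIdeal) →
      ∀ (DSsub : DatumDualData κ γ (charModule ∅ θsub)
          (AcSelmer.bdpData (charModule ∅ θsub) p vbar) (↑Sf : Set (HeightOneSpectrum (𝓞 K))))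
        (DSquot : DatumDualData κ γ (charModule ∅ θquot)
          (AcSelmer.bdpData (charModule ∅ θquot) p vbar) (↑Sf : Set (HeightOneSpectrum (𝓞 K)))),
      Module.Finite (IwasawaAlgebra p) (AcSelmer.XAc (W.baseChange K) p κ vbar (↑Sf : Set (HeightOneSpectrum (𝓞 K))) γ) →
      Module.IsTorsion (IwasawaAlgebra p) (AcSelmer.XAc (W.baseChange K) p κ vbar (↑Sf : Set (HeightOneSpectrum (𝓞 K))) γ) →
      muInvariant p (AcSelmer.XAc (W.baseChange K) p κ vbar (↑Sf : Set (HeightOneSpectrum (𝓞 K))) γ) = 0 →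
      (∀ D : DatumDualData κ γ (charModule ∅ θsub)
          (AcSelmer.bdpData (charModule ∅ θsub) p vbar) (↑Sf : Set (HeightOneSpectrum (𝓞 K))),
        Module.Finite (IwasawaAlgebra p) D.X ∧ Module.IsTorsion (IwasawaAlgebra p) D.X ∧ muInvariant p D.X = 0) →
      (∀ D : DatumDualData κ γ (charModule ∅ θquot)
          (AcSelmer.bdpData (charModule ∅ θquot) p vbar) (↑Sf : Set (HeightOneSpectrum (𝓞 K))),
        Module.Finite (IwasawaAlgebra p) D.X ∧ Module.IsTorsion (IwasawaAlgebra p) D.X ∧ muInvariant p D.X = 0) →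
      lambdaInvariant p DSsub.X + lambdaInvariant p DSquot.X ≤
        lambdaInvariant p (AcSelmer.XAc (W.baseChange K) p κ vbar (↑Sf : Set (HeightOneSpectrum (𝓞 K))) γ) +
          (if ∀ σ : absoluteGaloisGroup K, θquot σ = 1 then 1 else 0) := by
  intro W _ _ p _ hp hgood hred hanom hlat K _ _ hK hH hHp htor ι v vbar hv hvbar hne κ hκ γ _ θsub θquot hpair Sf hSf
    DSsub DSquot hfgS htorS hμS hSsub hSquot
  obtain ⟨h411, h422, h5A, h41, h42, h32, h33, hT4⟩ := stub_publishedFactsGreenberg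
  obtain ⟨c, τ, Φ, j₁, j₃, hj₁, hj₃, hτ, hdist, hreps₁, hreps₂, hreps₃, hj₁inj, hj₃inj, hr₁, hr₃, hr₂, hd₂, hUi, hU₁, hU₂,
    hU₃, hsur₁, hsur₂, hsur₃, hprim₁, hprim₂, hprim₃, hfin₁, hfin₂, hfin₃, hinv₁, hinv₂, hinv₃, hN₂, hfinq, hε, hN₁D,
    htrivD, hfinQ, hN₃, hinvD₁, hinvD₃, hH2⟩ :=
    GoodLatticeBDPValueIndexStubs.indexInputs h411 h422 h5A h41 h42 h32 h33 hT4 stub_publishedFactsMore.1 stub_publishedFactCD2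
      W p hp hgood hred hanom hlat K hK hH hHp htor ι v vbar hv hvbar hne κ hκ γ θsub θquot hpair Sf hSf hfgS htorS hμS hSsub
      hSquot
  haveI := hfin₁; haveI := hfin₂; haveI := hfin₃; haveI := hfinq; haveI := hfinQ
  haveI hEK : (W.baseChange K).IsElliptic := inferInstanceAs (W.map (algebraMap ℚ K)).IsElliptic
  have hcN₂ : ∀ b : ↥((W.baseChange K).geomTorsion (p : ℤ)), Continuous fun σ : absoluteGaloisGroup K ↦ σ • b :=
    fun b ↦ continuous_of_injective_comp (G := absoluteGaloisGroup K) Subtype.val_injective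
      ((W.baseChange K).continuous_smul_geomPoints (b : geomPoints (W.baseChange K)))
  -- DIV ×3 and LRS: `cd_p(ker κ ⊓ D_v̄) ≤ 1` (w4 gen 3, `AnticyclotomicLocalCdOne`)
  have hneD : ∃ τ ∈ decomp (K := K) vbar, κ τ ≠ 1 :=
    AnticyclotomicLocalCdOne.exists_mem_decomp_apply_ne_one_of_isAnticyclotomic κ vbar hK hp.ne' hκ hvbar
  have hdiv₁ : ∀ y : subgroupH1 (κ.kerSubgroup ⊓ decomp vbar) (charModule ∅ θsub), ∃ y', p • y' = y := fun y ↦ by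
    obtain ⟨y', hy'⟩ := AnticyclotomicLocalCdOne.exists_eq_nsmul_subgroupH1_inf_decomp κ vbar hneD
      (CharResidualSelmerCount.continuous_smul_charModule θsub) (CharResidualSelmerCount.charModule_divisible θsub) y
    exact ⟨y', hy'.symm⟩
  have hdiv₂ : ∀ y : subgroupH1 (κ.kerSubgroup ⊓ decomp vbar) ↥((W.baseChange K).geomPrimaryTorsion p),
      ∃ y', p • y' = y := fun y ↦ by
    obtain ⟨y', hy'⟩ := AnticyclotomicLocalCdOne.exists_eq_nsmul_subgroupH1_inf_decomp κ vbar hneD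
      ((W.baseChange K).continuous_smul_geomPrimaryTorsion p) hd₂ y
    exact ⟨y', hy'.symm⟩
  have hdiv₃ : ∀ y : subgroupH1 (κ.kerSubgroup ⊓ decomp vbar) (charModule ∅ θquot), ∃ y', p • y' = y := fun y ↦ by
    obtain ⟨y', hy'⟩ := AnticyclotomicLocalCdOne.exists_eq_nsmul_subgroupH1_inf_decomp κ vbar hneD
      (CharResidualSelmerCount.continuous_smul_charModule θquot) (CharResidualSelmerCount.charModule_divisible θquot) y
    exact ⟨y', hy'.symm⟩
  have hpQ : ∀ Q : ↥((W.baseChange K).geomTorsion (p : ℤ)), p • Q = 0 := fun Q ↦ by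
    apply Subtype.ext
    have h := (mem_geomTorsion_iff (W.baseChange K) (p : ℤ) (Q : geomPoints (W.baseChange K))).mp Q.2
    rw [AddSubmonoidClass.coe_nsmul, ← natCast_zsmul, h]
    rfl
  have hlrs := AnticyclotomicLocalCdOne.resH1Hom_id_surjective_inf_decomp κ vbar hneD
    (fun a ↦ Φ.continuous_smul_sub hcN₂ a) hcN₂ (fun a ↦ Φ.continuous_smul_quot hcN₂ a)
    (fun n ↦ ⟨1, Φ.incl_injective (by rw [map_nsmul, map_zero, pow_one]; exact hpQ _)⟩)
    Φ.incl Φ.incl_smul Φ.incl_injective Φ.proj Φ.proj_smul Φ.proj_incl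
    (fun b hb ↦ Φ.mem_range_incl_of_proj_eq_zero b hb) Φ.proj_surjective
  -- FIN: `E(K_{∞,w̄})[p^∞]` is finite (w2 gen 3, `AnomalousLocalTorsion`)
  haveI hfinED : Finite {x : ↥((W.baseChange K).geomPrimaryTorsion p) // ∀ g : ↥(κ.kerSubgroup ⊓ decomp vbar), g • x = x} := by
    have hF := AnomalousLocalTorsion.localTowerTorsionFiniteAt_of_isAnticyclotomic W hp.ne' hanom hlat hK
      (IwasawaTwoVariable.natCast_mem_asIdeal_of_norm_iff hv) hvbar hne κ hκ
    haveI := hF.to_subtype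
    refine Finite.of_injective (fun x ↦ (⟨x.1, (FixedPoints.mem_addSubgroup _ _ _).mpr fun g ↦
      x.2 ⟨g.1, by rw [inf_comm]; exact g.2⟩⟩ :
        (FixedPoints.addSubgroup ↥(decomp (K := K) vbar ⊓ κ.kerSubgroup) ↥((W.baseChange K).geomPrimaryTorsion p) :
          Set ↥((W.baseChange K).geomPrimaryTorsion p)))) fun a b h ↦ Subtype.ext ?_
    simpa using congrArg Subtype.val h
  have hmid := ResidualIndexAssembly.zpCorank_datumStrictSelmer_add_eq κ.kerSubgroup p
    (↑Sf : Set (HeightOneSpectrum (𝓞 K))) vbar hvbar Φ.incl Φ.proj Φ.incl_smul Φ.proj_smul Φ.incl_injective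
    Φ.proj_surjective (fun b hb ↦ Φ.mem_range_incl_of_proj_eq_zero b hb) Φ.proj_incl j₁
    (AddSubgroup.inclusion (geomTorsion_le_geomPrimaryTorsion (W.baseChange K) p)) j₃ hj₁ (fun _ _ ↦ rfl) hj₃ hj₁inj
    (AddSubgroup.inclusion_injective _) hj₃inj hr₁ hr₂ hr₃ (CharResidualSelmerCount.charModule_divisible θsub) hd₂
    (CharResidualSelmerCount.charModule_divisible θquot) (fun a ↦ Φ.continuous_smul_sub hcN₂ a) hcN₂
    (fun a ↦ Φ.continuous_smul_quot hcN₂ a) (CharResidualSelmerCount.continuous_smul_charModule θsub)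
    ((W.baseChange K).continuous_smul_geomPrimaryTorsion p) (CharResidualSelmerCount.continuous_smul_charModule θquot)
    hUi hU₁ hU₂ hU₃ c τ hreps₁ hreps₂ hreps₃ hsur₁ hsur₂ hsur₃ hdiv₁ hdiv₂ hdiv₃ hlrs hprim₁ hprim₂ hprim₃ hinv₁ hinv₂ hinv₃
    hN₂ hε hN₁D htrivD hN₃ hinvD₁ hinvD₃ hH2
  exact IndexPlumbingNrVsStrict.stub_indexPlumbing h411 h422 h5A h41 h42 h32 h33 hT4 stub_publishedFactsMore.1 W p hp hgood
    hred hanom hlat K hK hH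
    hHp htor ι v vbar hv hvbar hne κ hκ γ θsub θquot hpair Sf hSf DSsub DSquot c τ hτ hdist hreps₁ hreps₂ hreps₃ hsur₁ hsur₃
    hmid hfgS htorS hμS hSsub hSquot

end

end Summit.BirchSwinnertonDyer.BirchSwinnertonDyer.Theorems.GoodLatticeBDPValueOfNamedFactsALG
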